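import Mathlib.Algebra.Polynomial.Roots
import Mathlib.Algebra.Polynomial.OfFn
import Mathlib.NumberTheory.Bertrand
import Mathlib.Data.Nat.Prime.Infinite
import Mathlib.Data.ZMod.Basic
import Mathlib.Algebra.Field.ZMod
import Mathlib.Algebra.BigOperators.Ring.Finset
import Mathlib.Logic.Equiv.Prod
import Literature.Computability.MetaComplexity.NaturalProofs
import HarnessLib

/-!
# The Nisan–Wigderson generator: designs, the hybrid argument, natural properties as distinguishers

Trunk `CplxMeta`. First instalment of the decomposition of the named fact
`Literature.Computability.Learning.cikk_natural_implies_learning` (Carmosino–Impagliazzo–Kabanets–Kolokolova, CCC 2016,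
Thm. 5.1; `Literature/Computability/Learning/NaturalLearning.lean`): the COMBINATORIAL layer of
the proof — NW designs and their existence, the NW generator, distinguishing advantage, the
hybrid argument with Yao's distinguisher-to-predictor step (the correctness half of CIKK's
"NW reconstruction" Thm. 2.11), and the observation that a dense property avoided by all
generator outputs is a distinguisher (second paragraph of the proof of CIKK Thm. 5.1).
Everything here is proved; no algorithms, machines or circuits are involved (the uniform /
circuit-size halves of Thm. 2.11 and Thm. 5.1 are separate steps, see the plan in
`NaturalLearning.lean`).

## Contents

* `IsNWDesign a e` — a family of blocks `e i : β ↪ α` with pairwise intersections `≤ a`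
  (CIKK Def. 2.8; Arora–Barak Def. 20.13); `polyBlock`, `isNWDesign_polyBlock` — the polynomial
  designs (graphs of the polynomials `Polynomial.ofFn (d+1) c` of degree `≤ d` over a finite
  field meet in `≤ d` points; CIKK §3.1); the explicit `cikkDesign` (`evalPoints`, `pairEquiv`,
  `coeffVec`); `exists_isNWDesign` — for `n ≥ 2` and any index set of size `≤ 2^ℓ`, blocks of
  size `n`, intersections `≤ ℓ`, universe `Fin m` with `m ≤ 4n²` (CIKK Thm. 3.3 parameters,
  via Bertrand's postulate).
* `nwGenerator e f z = (i ↦ f (z ∘ e i))` (CIKK Def. 2.9; Arora–Barak Def. 20.12).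
* `acceptProb D`, `acceptProbOn D G`, `advantage D G = Pr_z[D(G z)] - Pr_y[D y]` (CIKK
  Def. 2.10: `D ∈ DIS(G, ε) ↔ ε < advantage D G`), with `advantage_not`, reindexing invariance,
  and `prgAdvantage_eq_abs_advantage` linking Razborov–Rudich's `prgAdvantage`
  (`NaturalProofs.lean`).
* `hybrid`, `hybridProb`, `advantage_eq_sum_hybridProb` (telescoping), `nwPredictor`
  (the predictor of the NW reconstruction: complete the challenge `x`, placed on block `i`, by
  the advice `z`, evaluate `D` on the `i`-th hybrid with advice `w`, answer `wᵢ` iff `D`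
  accepts), `predictorAgreement_eq` (Yao: averaged agreement `= 1/2 + gap_i`),
  `sum_predictorAgreement_div` (average over `i` is `1/2 + advantage/L`) and
  `exists_nwPredictor_agreement_ge` (some advice achieves it) — CIKK Thm. 2.11 / Arora–Barak
  proof of Lemma 20.15 with Thm. 20.10 (Yao).
* `propertyTest R ℓ` (indicator of `R_ℓ` on truth tables), `acceptProb_propertyTest_ge`
  (density `1/q` ⇒ acceptance `≥ 1/q`), `forall_not_mem_of_useful` +
  `acceptProbOn_propertyTest_eq_zero` (usefulness ⇒ no pseudorandom string accepted),
  `advantage_not_propertyTest_ge` (so `¬R_ℓ` has advantage `≥ 1/q`; CIKK Thm. 5.1, proof ¶2).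

## Design choices

* Designs are presented by block EMBEDDINGS `e i : β ↪ α` (block positions indexed by a
  finite type `β`, e.g. `Fin n` or the input positions of an amplified function) rather than
  `n`-subsets, so that the restriction `z|_{Sᵢ}` is the honest function `z ∘ e i : β → Bool`
  (no choice of an enumeration); the block as a set is `univ.map (e i)`.
* Probabilities over uniform finite spaces are exact counts `#{…}/|Ω|` in `ℝ`, as in
  `prgAdvantage`; proofs go through `Finset.natCast_card_filter` and bijections
  (`overwrite_involutive`: completing a uniform block by uniform outside bits is uniform;
  `sum_eq_half_sum_update`: pairing `w` with `w ⊕ eᵢ`).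
* The hybrid section indexes outputs by `Fin L` (hybrids need the order); other output index
  sets (truth-table positions `{0,1}^ℓ`) are reached by `advantage_reindex` /
  `nwGenerator_reindex`.
* Correctness of the predictor needs NO design property; the design only bounds the SIZE of the
  predictor (each `f(z'|_{Sⱼ})`, `j < i`, depends on `≤ a` bits of `x`), which is not treated here.

## References

* M. Carmosino, R. Impagliazzo, V. Kabanets, A. Kolokolova, *Learning algorithms from natural
  proofs*, CCC 2016, LIPIcs 50, 10:1–10:24, Defs. 2.8–2.10, Thm. 2.11, §3.1 (Thms. 3.3, 3.6),
  Thm. 5.1 [CarmosinoImpagliazzoKabanetsKolokolova2016] (text checked: core.ac.uk OA copy).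
* N. Nisan, A. Wigderson, *Hardness vs randomness*, JCSS 49 (1994) 149–167 (designs from
  polynomials; the generator; the hybrid/predictor argument).
* S. Arora, B. Barak, *Computational Complexity: A Modern Approach*, CUP 2009, Def. 20.12
  (NW generator), Def. 20.13 (combinatorial designs), Thm. 20.10 (Yao), Lemma 20.15 and its
  proof (pp. 411–412) [AroraBarak2009].
* A. C.-C. Yao, *Theory and applications of trapdoor functions*, FOCS 1982.
-/

namespace Literature.Computability.MetaComplexity

open Finset Polynomial

/-! ### NW designs -/

section Design

variable {α ι β : Type*} [Fintype β] {n : ℕ}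

/-- An **NW design** with intersection parameter `a`, presented by block embeddings: a family
`e i : β ↪ α` of blocks `Sᵢ = range (e i)` of the seed universe `α` (block positions indexed by
a finite type `β`, `|β| = n`; typically `β = Fin n`), such that `|Sᵢ ∩ Sⱼ| ≤ a` for `i ≠ j`
(CIKK Def. 2.8 has `α = [m]`, `a = log L`; Arora–Barak Def. 20.13).
[cite: CarmosinoImpagliazzoKabanetsKolokolova2016, Def. 2.8] -/
def IsNWDesign [DecidableEq α] (a : ℕ) (e : ι → (β ↪ α)) : Prop :=
  ∀ ⦃i j : ι⦄, i ≠ j → (univ.map (e i) ∩ univ.map (e j)).card ≤ a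

/-- The design condition is monotone in the intersection parameter. [folklore] -/
theorem IsNWDesign.mono [DecidableEq α] {a a' : ℕ} {e : ι → (β ↪ α)} (h : IsNWDesign a e)
    (ha : a ≤ a') : IsNWDesign a' e := fun _ _ hij => (h hij).trans ha

/-- Re-indexing a design along an injection of index sets preserves the design property.
[folklore] -/
theorem IsNWDesign.comp_injective [DecidableEq α] {κ : Type*} {a : ℕ} {e : ι → (β ↪ α)}
    (h : IsNWDesign a e) {g : κ → ι} (hg : Function.Injective g) : IsNWDesign a (e ∘ g) :=
  fun _ _ hij => h (hg.ne hij)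

/-- Re-indexing the block positions along a bijection preserves the design property.
[folklore] -/
theorem IsNWDesign.precomp [DecidableEq α] {β' : Type*} [Fintype β'] {a : ℕ} {e : ι → (β ↪ α)}
    (h : IsNWDesign a e) (v : β' ≃ β) : IsNWDesign a (fun i => v.toEmbedding.trans (e i)) := by
  intro i j hij
  have hm : ∀ i, univ.map (v.toEmbedding.trans (e i)) = univ.map (e i) := fun i => by
    rw [← map_map, Finset.map_univ_equiv]
  rw [hm, hm]
  exact h hij

/-- Transporting the universe along an embedding preserves the design property. [folklore] -/
theorem IsNWDesign.trans [DecidableEq α] {γ : Type*} [DecidableEq γ] {a : ℕ}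
    {e : ι → (β ↪ α)} (h : IsNWDesign a e) (u : α ↪ γ) :
    IsNWDesign a (fun i => (e i).trans u) := by
  intro i j hij
  have : univ.map ((e i).trans u) ∩ univ.map ((e j).trans u) =
      (univ.map (e i) ∩ univ.map (e j)).map u := by
    rw [map_inter, map_map, map_map]
  rw [this, card_map]
  exact h hij

/-! #### The polynomial designs of Nisan–Wigderson -/

variable {F : Type*} [Field F] [DecidableEq F]

/-- Evaluating Mathlib's coefficient-vector polynomial `Polynomial.ofFn n c`:
`p_c(a) = Σⱼ cⱼ aʲ` (not in Mathlib's `OfFn` API). [folklore] -/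
theorem eval_ofFn_eq_sum {m : ℕ} (c : Fin m → F) (a : F) :
    (ofFn m c).eval a = ∑ j : Fin m, c j * a ^ (j : ℕ) := by
  rw [ofFn_eq_sum_monomial, eval_finsetSum]
  simp only [eval_monomial]

/-- The **polynomial design block** of the coefficient vector `c` over the evaluation points
`A : Fin n ↪ F`: `k ↦ (A k, p_c (A k))`, the graph of the polynomial `p_c = Polynomial.ofFn (d+1) c`
of degree `≤ d` (Mathlib's coefficient-vector polynomial) on `range A`, an `n`-element block of
the universe `F × F`. [Arora–Barak 2009, Def. 20.13; CIKK §3.1]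
[cite: CarmosinoImpagliazzoKabanetsKolokolova2016, §3.1] -/
noncomputable def polyBlock {d : ℕ} (A : Fin n ↪ F) (c : Fin (d + 1) → F) : Fin n ↪ F × F :=
  ⟨fun k => (A k, (ofFn (d + 1) c).eval (A k)), fun _ _ h => A.injective (Prod.ext_iff.1 h).1⟩

/-- Unfolding `polyBlock`. [folklore] -/
@[simp] theorem polyBlock_apply {d : ℕ} (A : Fin n ↪ F) (c : Fin (d + 1) → F) (k : Fin n) :
    polyBlock A c k = (A k, (ofFn (d + 1) c).eval (A k)) := rfl

/-- **Polynomial designs are NW designs**: the graphs of two distinct polynomials of degree `≤ d`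
meet in at most `d` points. [Arora–Barak 2009, Def. 20.13; CIKK §3.1]
[cite: CarmosinoImpagliazzoKabanetsKolokolova2016, §3.1] -/
theorem isNWDesign_polyBlock (d : ℕ) (A : Fin n ↪ F) :
    IsNWDesign d (polyBlock (d := d) A) := by
  intro c c' hcc'
  set p : F[X] := ofFn (d + 1) c - ofFn (d + 1) c' with hp
  have hpc : p = ofFn (d + 1) (c - c') := by rw [hp, map_sub]
  have hp0 : p ≠ 0 := by
    rw [hpc, Ne, ← map_zero (ofFn (R := F) (d + 1)), (injective_ofFn (d + 1)).eq_iff, sub_eq_zero]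
    exact hcc'
  -- the intersection embeds into the root set of `p`
  have hsub : univ.map (polyBlock A c) ∩ univ.map (polyBlock A c') ⊆
      p.roots.toFinset.image fun a => (a, (ofFn (d + 1) c).eval a) := by
    intro x hx
    rw [mem_inter, mem_map, mem_map] at hx
    obtain ⟨⟨k, -, hk⟩, ⟨k', -, hk'⟩⟩ := hx
    rw [mem_image]
    refine ⟨x.1, ?_, ?_⟩
    · rw [Multiset.mem_toFinset, mem_roots hp0, IsRoot.def, hp, eval_sub, sub_eq_zero]
      have h1 : (ofFn (d + 1) c).eval x.1 = x.2 := by rw [← hk]; rfl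
      have h2 : (ofFn (d + 1) c').eval x.1 = x.2 := by rw [← hk']; rfl
      rw [h1, h2]
    · rw [← hk]; rfl
  calc (univ.map (polyBlock A c) ∩ univ.map (polyBlock A c')).card
      ≤ (p.roots.toFinset.image fun a => (a, (ofFn (d + 1) c).eval a)).card := card_le_card hsub
    _ ≤ p.roots.toFinset.card := card_image_le
    _ ≤ Multiset.card p.roots := Multiset.toFinset_card_le _
    _ ≤ p.natDegree := card_roots' p
    _ ≤ d := by
        have := ofFn_natDegree_lt (R := F) (n := d + 1) (by omega) (c - c')
        rw [← hpc] at this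
        omega

/-! #### The explicit design of CIKK §3.1 -/

/-- The evaluation points `0, 1, …, n-1 ∈ 𝔽_q` (`n ≤ q`; CIKK: "the first `n` field elements
`r₁, …, rₙ`"). [cite: CarmosinoImpagliazzoKabanetsKolokolova2016, §3.1] -/
def evalPoints (q n : ℕ) [NeZero q] (hn : n ≤ q) : Fin n ↪ ZMod q :=
  ⟨fun k => ((k : ℕ) : ZMod q), fun k k' h => by
    apply Fin.ext
    have h' := congrArg ZMod.val h
    rwa [ZMod.val_natCast, ZMod.val_natCast, Nat.mod_eq_of_lt (lt_of_lt_of_le k.isLt hn),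
      Nat.mod_eq_of_lt (lt_of_lt_of_le k'.isLt hn)] at h'⟩

/-- Unfolding `evalPoints`. [folklore] -/
@[simp] theorem evalPoints_apply (q n : ℕ) [NeZero q] (hn : n ≤ q) (k : Fin n) :
    evalPoints q n hn k = ((k : ℕ) : ZMod q) := rfl

/-- The explicit enumeration `(a, b) ↦ b + q·a` of the universe `𝔽_q × 𝔽_q` by `Fin (q·q)`
(CIKK: "arrange the elements of the universe `[m]` on a grid"): Mathlib's `ZMod.finEquiv` on
both coordinates followed by `finProdFinEquiv`.
[cite: CarmosinoImpagliazzoKabanetsKolokolova2016, §3.1] -/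
def pairEquiv (q : ℕ) [NeZero q] : ZMod q × ZMod q ≃ Fin (q * q) :=
  ((ZMod.finEquiv q).toEquiv.symm.prodCongr (ZMod.finEquiv q).toEquiv.symm).trans finProdFinEquiv

/-- `pairEquiv` as an embedding. [folklore] -/
def pairIndex (q : ℕ) [NeZero q] : ZMod q × ZMod q ↪ Fin (q * q) := (pairEquiv q).toEmbedding

/-- The `0/1` coefficient vector of an index string `i ∈ {0,1}^ℓ`, padded by a zero top
coefficient (CIKK: "`i` corresponds to the polynomial `A_i(x) = Σⱼ iⱼ x^{j-1}`").
[cite: CarmosinoImpagliazzoKabanetsKolokolova2016, §3.1] -/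
def coeffVec {F : Type*} [Zero F] [One F] {ℓ : ℕ} (i : Fin ℓ → Bool) : Fin (ℓ + 1) → F :=
  fun j => if h : (j : ℕ) < ℓ then (if i ⟨j, h⟩ then 1 else 0) else 0

omit [Field F] [DecidableEq F] in
/-- Distinct index strings have distinct coefficient vectors (in a field, `1 ≠ 0`). [folklore] -/
theorem coeffVec_injective (F : Type*) [MulZeroOneClass F] [Nontrivial F] (ℓ : ℕ) :
    Function.Injective (coeffVec (F := F) (ℓ := ℓ)) := by
  intro i i' h
  funext j
  have hj := congrFun h ⟨j, Nat.lt_succ_of_lt j.isLt⟩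
  simp only [coeffVec, j.isLt, dif_pos, Fin.eta] at hj
  cases hi : i j <;> cases hi' : i' j <;> simp_all

/-- Evaluating the polynomial with `0/1` coefficient string `i`: `A_i(a) = Σ_{j : i j} aʲ`.
[folklore] -/
theorem eval_ofFn_coeffVec {F : Type*} [Field F] [DecidableEq F] {ℓ : ℕ} (i : Fin ℓ → Bool)
    (a : F) :
    (ofFn (ℓ + 1) (coeffVec i : Fin (ℓ + 1) → F)).eval a =
      ∑ j : Fin ℓ, if i j = true then a ^ (j : ℕ) else 0 := by
  rw [eval_ofFn_eq_sum, Fin.sum_univ_castSucc]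
  have hlast : (coeffVec i : Fin (ℓ + 1) → F) (Fin.last ℓ) = 0 := by simp [coeffVec]
  rw [hlast, zero_mul, add_zero]
  refine Finset.sum_congr rfl fun j _ => ?_
  have : (coeffVec i : Fin (ℓ + 1) → F) j.castSucc = if i j = true then 1 else 0 := by
    simp [coeffVec, j.isLt]
  rw [this]
  split_ifs <;> simp

/-- **The explicit NW design of CIKK §3.1** with block size `n`, `2^ℓ` blocks indexed by
`{0,1}^ℓ`, universe `Fin (q·q)` for a prime `q ≥ n`: block `i` is the graph
`{(r_k, A_i(r_k)) : k < n}` of the polynomial with `0/1` coefficient string `i`.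
[cite: CarmosinoImpagliazzoKabanetsKolokolova2016, §3.1 (proof of Thm. 3.6)] -/
noncomputable def cikkDesign (q n ℓ : ℕ) [Fact q.Prime] (hn : n ≤ q) :
    (Fin ℓ → Bool) → (Fin n ↪ Fin (q * q)) :=
  fun i => (polyBlock (evalPoints q n hn) (coeffVec i : Fin (ℓ + 1) → ZMod q)).trans (pairIndex q)

/-- The explicit design has pairwise intersections `≤ ℓ`.
[cite: CarmosinoImpagliazzoKabanetsKolokolova2016, §3.1 (proof of Thm. 3.6)] -/
theorem isNWDesign_cikkDesign (q n ℓ : ℕ) [Fact q.Prime] (hn : n ≤ q) :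
    IsNWDesign ℓ (cikkDesign q n ℓ hn) :=
  ((isNWDesign_polyBlock ℓ (evalPoints q n hn)).comp_injective
    (coeffVec_injective (ZMod q) ℓ)).trans (pairIndex q)

/-- The least prime `≥ n` (the field size used by the learner; `≤ 2n` by Bertrand).
[cite: CarmosinoImpagliazzoKabanetsKolokolova2016, §3.1 ("a field of size `O(n)`")] -/
noncomputable def leastPrimeGe (n : ℕ) : ℕ := Nat.find (Nat.exists_infinite_primes n)

/-- `leastPrimeGe n` is a prime `≥ n`. [folklore] -/
theorem leastPrimeGe_spec (n : ℕ) : n ≤ leastPrimeGe n ∧ (leastPrimeGe n).Prime :=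
  Nat.find_spec (Nat.exists_infinite_primes n)

/-- Bertrand: `leastPrimeGe n ≤ 2 n` for `n ≥ 1`. [folklore] -/
theorem leastPrimeGe_le (n : ℕ) (hn : n ≠ 0) : leastPrimeGe n ≤ 2 * n := by
  obtain ⟨p, hp, hnp, hp2⟩ := Nat.exists_prime_lt_and_le_two_mul n hn
  exact (Nat.find_min' _ ⟨hnp.le, hp⟩).trans hp2

/-! #### Designs with the CIKK parameters -/

/-- **NW designs exist with the parameters of CIKK Thm. 3.3** (combinatorial part), blocks
indexed by the truth-table positions `{0,1}^ℓ`: for every block size `n` and every `ℓ` there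
are blocks of size `n` in a universe of size `m ≤ 4 n²` with pairwise intersections `≤ ℓ`
(for `n ≥ 1` the explicit `cikkDesign` over `𝔽_q`, `q = leastPrimeGe n ≤ 2n`; `m = 0` for
`n = 0`). The
`AC⁰[p]`-computability assertion of CIKK Thm. 3.3/3.6 is NOT part of this statement.
[cite: CarmosinoImpagliazzoKabanetsKolokolova2016, Thm. 3.3 and §3.1] -/
theorem exists_isNWDesign_truthTable (n ℓ : ℕ) :
    ∃ m : ℕ, m ≤ 4 * n ^ 2 ∧ ∃ e : (Fin ℓ → Bool) → (Fin n ↪ Fin m), IsNWDesign ℓ e := by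
  rcases Nat.eq_zero_or_pos n with rfl | hn
  · -- empty blocks in the empty universe
    refine ⟨0, le_rfl, fun _ => ⟨Fin.elim0, fun a => Fin.elim0 a⟩, fun i j _ => ?_⟩
    simp
  obtain ⟨hnq, hq⟩ := leastPrimeGe_spec n
  haveI : Fact (leastPrimeGe n).Prime := ⟨hq⟩
  have h2 := leastPrimeGe_le n hn.ne'
  exact ⟨leastPrimeGe n * leastPrimeGe n, by nlinarith, cikkDesign _ n ℓ hnq,
    isNWDesign_cikkDesign _ n ℓ hnq⟩

/-- The same for any index set of size `≤ 2^ℓ` (e.g. `Fin (2^ℓ)`), by re-indexing along an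
injection into `{0,1}^ℓ`. [cite: CarmosinoImpagliazzoKabanetsKolokolova2016, Thm. 3.3] -/
theorem exists_isNWDesign (ι : Type*) [Fintype ι] (n ℓ : ℕ) (hι : Fintype.card ι ≤ 2 ^ ℓ) :
    ∃ m : ℕ, m ≤ 4 * n ^ 2 ∧ ∃ e : ι → (Fin n ↪ Fin m), IsNWDesign ℓ e := by
  obtain ⟨m, hm, e, he⟩ := exists_isNWDesign_truthTable n ℓ
  have hI : Nonempty (ι ↪ (Fin ℓ → Bool)) :=
    Function.Embedding.nonempty_of_card_le (by simpa using hι)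
  obtain ⟨idx⟩ := hI
  exact ⟨m, hm, e ∘ idx, he.comp_injective idx.injective⟩

end Design

/-! ### The NW generator -/

section Generator

variable {α ι β : Type*}

/-- **The Nisan–Wigderson generator** of `f : {0,1}^β → {0,1}` on the design `e`: the seed
`z : α → Bool` is mapped to the string `i ↦ f (z|_{Sᵢ})`, the block `Sᵢ` being read through
`e i`. (CIKK Def. 2.9: `G_f(z) = f(z|_{S₁}) ⋯ f(z|_{S_L})`; for the learning application the
output index set is `ι = {0,1}^ℓ`, so that `G_f(z)` is the truth table of an `ℓ`-variate
function.) [cite: CarmosinoImpagliazzoKabanetsKolokolova2016, Def. 2.9] -/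
def nwGenerator (e : ι → (β ↪ α)) (f : (β → Bool) → Bool) (z : α → Bool) : ι → Bool :=
  fun i => f (z ∘ e i)

/-- Unfolding the NW generator. [folklore] -/
@[simp] theorem nwGenerator_apply (e : ι → (β ↪ α)) (f : (β → Bool) → Bool)
    (z : α → Bool) (i : ι) : nwGenerator e f z i = f (z ∘ e i) := rfl

/-- Reindexing the blocks reindexes the output. [folklore] -/
theorem nwGenerator_reindex {ι' : Type*} (π : ι ≃ ι') (e : ι → (β ↪ α))
    (f : (β → Bool) → Bool) (z : α → Bool) :
    nwGenerator (e ∘ π.symm) f z = nwGenerator e f z ∘ π.symm := rfl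

end Generator

/-! ### Acceptance probabilities and distinguishing advantage -/

section Advantage

variable {σ κ : Type*} [Fintype σ] [DecidableEq σ]

section AcceptProb

variable [Fintype κ] [DecidableEq κ]

/-- `Pr_y[D(y) = 1]` for `y` uniform on `{0,1}^κ` (exact count divided by `2^{|κ|}`).
[cite: CarmosinoImpagliazzoKabanetsKolokolova2016, Def. 2.10] -/
noncomputable def acceptProb (D : (κ → Bool) → Bool) : ℝ :=
  ((univ.filter fun y : κ → Bool => D y = true).card : ℝ) / Fintype.card (κ → Bool)

end AcceptProb

/-- `Pr_z[D(G(z)) = 1]` for a seed `z` uniform on `{0,1}^σ`.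
[cite: CarmosinoImpagliazzoKabanetsKolokolova2016, Def. 2.10] -/
noncomputable def acceptProbOn (D : (κ → Bool) → Bool) (G : (σ → Bool) → (κ → Bool)) : ℝ :=
  ((univ.filter fun z : σ → Bool => D (G z) = true).card : ℝ) / Fintype.card (σ → Bool)

omit [Fintype σ] [DecidableEq σ] in
/-- Indicator of a negated Boolean test. [folklore] -/
theorem ite_not_eq_true_eq (b : Bool) :
    (if (!b) = true then (1 : ℝ) else 0) = 1 - (if b = true then (1 : ℝ) else 0) := by
  cases b <;> simp

omit [Fintype σ] [DecidableEq σ] in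
/-- Sum of the indicators of a negated test. [folklore] -/
theorem sum_ite_not {Ω : Type*} [Fintype Ω] (P : Ω → Bool) :
    (∑ ω, if (!P ω) = true then (1 : ℝ) else 0) =
      Fintype.card Ω - ∑ ω, if P ω = true then (1 : ℝ) else 0 := by
  simp_rw [ite_not_eq_true_eq, Finset.sum_sub_distrib, Finset.sum_const, Finset.card_univ,
    nsmul_eq_mul, mul_one]

/-- `Pr_z[¬D(G z)] = 1 - Pr_z[D(G z)]`. [folklore] -/
theorem acceptProbOn_not (D : (κ → Bool) → Bool) (G : (σ → Bool) → (κ → Bool)) :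
    acceptProbOn (fun y => !D y) G = 1 - acceptProbOn D G := by
  unfold acceptProbOn
  have hc : (0 : ℝ) < Fintype.card (σ → Bool) := Nat.cast_pos.2 Fintype.card_pos
  rw [natCast_card_filter, natCast_card_filter, sum_ite_not (fun z => D (G z)), sub_div,
    div_self hc.ne']

/-- Acceptance probabilities lie in `[0, 1]`. [folklore] -/
theorem acceptProbOn_nonneg (D : (κ → Bool) → Bool) (G : (σ → Bool) → (κ → Bool)) :
    0 ≤ acceptProbOn D G := by
  unfold acceptProbOn; positivity

/-- Acceptance probabilities lie in `[0, 1]`. [folklore] -/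
theorem acceptProbOn_le_one (D : (κ → Bool) → Bool) (G : (σ → Bool) → (κ → Bool)) :
    acceptProbOn D G ≤ 1 := by
  unfold acceptProbOn
  have hc : (0 : ℝ) < Fintype.card (σ → Bool) := Nat.cast_pos.2 Fintype.card_pos
  rw [div_le_one hc, ← Finset.card_univ]
  exact_mod_cast card_filter_le _ _

variable [Fintype κ] [DecidableEq κ]

/-- The (signed) **distinguishing advantage** `Pr_z[D(G z) = 1] - Pr_y[D(y) = 1]` of a test `D`
against a generator `G : {0,1}^σ → {0,1}^κ`; CIKK's `D ∈ DIS(G, ε)` is `ε < advantage D G`.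
[cite: CarmosinoImpagliazzoKabanetsKolokolova2016, Def. 2.10] -/
noncomputable def advantage (D : (κ → Bool) → Bool) (G : (σ → Bool) → (κ → Bool)) : ℝ :=
  acceptProbOn D G - acceptProb D

/-- `Pr[¬D] = 1 - Pr[D]`. [folklore] -/
theorem acceptProb_not (D : (κ → Bool) → Bool) :
    acceptProb (fun y => !D y) = 1 - acceptProb D := by
  unfold acceptProb
  have hc : (0 : ℝ) < Fintype.card (κ → Bool) := Nat.cast_pos.2 Fintype.card_pos
  rw [natCast_card_filter, natCast_card_filter, sum_ite_not, sub_div, div_self hc.ne']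

/-- Negating the test negates the advantage. [folklore] -/
theorem advantage_not (D : (κ → Bool) → Bool) (G : (σ → Bool) → (κ → Bool)) :
    advantage (fun y => !D y) G = -advantage D G := by
  rw [advantage, advantage, acceptProb_not, acceptProbOn_not]; ring

/-- Acceptance probabilities lie in `[0, 1]`. [folklore] -/
theorem acceptProb_nonneg (D : (κ → Bool) → Bool) : 0 ≤ acceptProb D := by
  unfold acceptProb; positivity

/-- Acceptance probabilities lie in `[0, 1]`. [folklore] -/
theorem acceptProb_le_one (D : (κ → Bool) → Bool) : acceptProb D ≤ 1 := by
  unfold acceptProb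
  have hc : (0 : ℝ) < Fintype.card (κ → Bool) := Nat.cast_pos.2 Fintype.card_pos
  rw [div_le_one hc, ← Finset.card_univ]
  exact_mod_cast card_filter_le _ _

/-- The advantage is at most `1` in absolute value. [folklore] -/
theorem abs_advantage_le_one (D : (κ → Bool) → Bool) (G : (σ → Bool) → (κ → Bool)) :
    |advantage D G| ≤ 1 := by
  rw [advantage, abs_sub_le_iff]
  constructor <;> linarith [acceptProb_nonneg D, acceptProb_le_one D, acceptProbOn_nonneg D G,
    acceptProbOn_le_one D G]

/-- Reindexing the output positions along a bijection does not change `Pr_y[D(y)]`.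
[folklore] -/
theorem acceptProb_reindex {κ' : Type*} [Fintype κ'] [DecidableEq κ'] (π : κ ≃ κ')
    (D : (κ → Bool) → Bool) : acceptProb (fun y : κ' → Bool => D (y ∘ π)) = acceptProb D := by
  unfold acceptProb
  rw [natCast_card_filter, natCast_card_filter,
    Fintype.card_congr (Equiv.arrowCongr π (Equiv.refl Bool)).symm,
    ← Equiv.sum_comp (Equiv.arrowCongr π (Equiv.refl Bool))]
  congr 1
  refine Finset.sum_congr rfl fun y _ => ?_
  have : ((Equiv.arrowCongr π (Equiv.refl Bool)) y) ∘ π = y := by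
    funext k; simp [Equiv.arrowCongr_apply]
  simp only [this]

omit [Fintype κ] [DecidableEq κ] in
/-- Reindexing the output positions does not change `Pr_z[D(G z)]`. [folklore] -/
theorem acceptProbOn_reindex {κ' : Type*} (π : κ ≃ κ') (D : (κ → Bool) → Bool)
    (G : (σ → Bool) → (κ → Bool)) :
    acceptProbOn (fun y : κ' → Bool => D (y ∘ π)) (fun z => G z ∘ π.symm) = acceptProbOn D G := by
  unfold acceptProbOn
  simp only [Function.comp_assoc, Equiv.symm_comp_self, Function.comp_id]

/-- Reindexing the output positions does not change the advantage. [folklore] -/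
theorem advantage_reindex {κ' : Type*} [Fintype κ'] [DecidableEq κ'] (π : κ ≃ κ')
    (D : (κ → Bool) → Bool) (G : (σ → Bool) → (κ → Bool)) :
    advantage (fun y : κ' → Bool => D (y ∘ π)) (fun z => G z ∘ π.symm) = advantage D G := by
  rw [advantage, advantage, acceptProb_reindex, acceptProbOn_reindex]

end Advantage

/-- Razborov–Rudich's `prgAdvantage` of a circuit (`NaturalProofs.lean`) is the absolute value
of the signed advantage of the function it computes. [folklore] -/
theorem prgAdvantage_eq_abs_advantage {k m : ℕ} (C : Literature.Computability.Complexity.Circuit (Fin m))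
    (g : (Fin k → Bool) → (Fin m → Bool)) :
    prgAdvantage C g = |advantage C.eval g| := by
  simp [prgAdvantage, advantage, acceptProbOn, acceptProb, Fintype.card_bool, Fintype.card_fin]

/-! ### Hybrids and the NW predictor (Thm. 2.11, correctness part) -/

section Hybrid

variable {α β : Type*} [Fintype α] [DecidableEq α] {L : ℕ}
variable (e : Fin L → (β ↪ α)) (f : (β → Bool) → Bool) (D : (Fin L → Bool) → Bool)

/-- The `i`-th **hybrid** between a uniform string `w` and the generator output on seed `z`:
the first `i` positions are those of `G_f(z)`, the remaining ones those of `w`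
(`H₀ = w`, `H_L = G_f(z)`). [Arora–Barak 2009, proof of Lemma 20.15]
[cite: CarmosinoImpagliazzoKabanetsKolokolova2016, §2.4 (NW reconstruction algorithm)] -/
def hybrid (i : ℕ) (z : α → Bool) (w : Fin L → Bool) : Fin L → Bool :=
  fun j => if (j : ℕ) < i then f (z ∘ e j) else w j

omit [Fintype α] [DecidableEq α] in
/-- `H₀ = w`. [folklore] -/
@[simp] theorem hybrid_zero (z : α → Bool) (w : Fin L → Bool) : hybrid e f 0 z w = w := by
  funext j; simp [hybrid]

omit [Fintype α] [DecidableEq α] in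
/-- `H_L = G_f(z)`. [folklore] -/
@[simp] theorem hybrid_length (z : α → Bool) (w : Fin L → Bool) :
    hybrid e f L z w = nwGenerator e f z := by
  funext j; simp [hybrid, j.isLt]

omit [Fintype α] [DecidableEq α] in
/-- `H_{i+1}` is `H_i` with position `i` overwritten by the true bit `f(z|_{Sᵢ})`. [folklore] -/
theorem hybrid_succ (i : Fin L) (z : α → Bool) (w : Fin L → Bool) :
    hybrid e f ((i : ℕ) + 1) z w = Function.update (hybrid e f i z w) i (f (z ∘ e i)) := by
  funext j
  by_cases hj : j = i
  · subst hj; simp [hybrid]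
  · have hne : (j : ℕ) ≠ i := fun h => hj (Fin.ext h)
    rw [Function.update_of_ne hj]
    simp only [hybrid]
    by_cases hlt : (j : ℕ) < i
    · simp [hlt, Nat.lt_succ_of_lt hlt]
    · have : ¬ ((j : ℕ) < i + 1) := by omega
      simp [hlt, this]

omit [Fintype α] [DecidableEq α] in
/-- Changing position `i` of `w` changes position `i` of `H_i`. [folklore] -/
theorem hybrid_update (i : Fin L) (z : α → Bool) (w : Fin L → Bool) (b : Bool) :
    hybrid e f i z (Function.update w i b) = Function.update (hybrid e f i z w) i b := by
  funext j
  by_cases hj : j = i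
  · subst hj; simp [hybrid]
  · rw [Function.update_of_ne hj]
    simp [hybrid, Function.update_of_ne hj]

/-- `Pr_{z,w}[D(H_i) = 1]`, the acceptance probability of the `i`-th hybrid.
[Arora–Barak 2009, proof of Lemma 20.15] [folklore] -/
noncomputable def hybridProb (i : ℕ) : ℝ :=
  ((univ.filter fun p : (α → Bool) × (Fin L → Bool) => D (hybrid e f i p.1 p.2) = true).card : ℝ) /
    Fintype.card ((α → Bool) × (Fin L → Bool))

/-- `Pr[D(H₀)] = Pr_y[D(y)]`. [folklore] -/
theorem hybridProb_zero : hybridProb e f D 0 = acceptProb D := by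
  unfold hybridProb acceptProb
  rw [natCast_card_filter, natCast_card_filter, Fintype.card_prod, Fintype.sum_prod_type]
  simp only [hybrid_zero, Finset.sum_const, Finset.card_univ, nsmul_eq_mul, Nat.cast_mul]
  have hc : (0 : ℝ) < Fintype.card (α → Bool) := Nat.cast_pos.2 Fintype.card_pos
  rw [mul_div_mul_left _ _ hc.ne']

/-- `Pr[D(H_L)] = Pr_z[D(G_f z)]`. [folklore] -/
theorem hybridProb_length : hybridProb e f D L = acceptProbOn D (nwGenerator e f) := by
  unfold hybridProb acceptProbOn
  rw [natCast_card_filter, natCast_card_filter, Fintype.card_prod, Fintype.sum_prod_type]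
  simp only [hybrid_length, Finset.sum_const, Finset.card_univ, nsmul_eq_mul, Nat.cast_mul]
  have hc : (0 : ℝ) < Fintype.card (Fin L → Bool) := Nat.cast_pos.2 Fintype.card_pos
  rw [← Finset.mul_sum, mul_comm (Fintype.card (α → Bool) : ℝ), mul_div_mul_left _ _ hc.ne']

/-- **The hybrid argument** (telescoping): the advantage of `D` against `G_f` is the sum over
`i < L` of the gaps `Pr[D(H_{i+1})] - Pr[D(H_i)]`. [Arora–Barak 2009, proof of Lemma 20.15]
[cite: CarmosinoImpagliazzoKabanetsKolokolova2016, Thm. 2.11] -/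
theorem advantage_eq_sum_hybridProb :
    advantage D (nwGenerator e f) =
      ∑ i : Fin L, (hybridProb e f D ((i : ℕ) + 1) - hybridProb e f D i) := by
  rw [Fin.sum_univ_eq_sum_range (fun i => hybridProb e f D (i + 1) - hybridProb e f D i) L,
    Finset.sum_range_sub, hybridProb_zero, hybridProb_length, advantage]

/-- The predictor's answer as a function of the COMPLETED seed `z'` and `w`: `wᵢ` if `D`
accepts the `i`-th hybrid `H_i(z', w)`, `¬wᵢ` otherwise. [Arora–Barak 2009, proof of
Lemma 20.15] [folklore] -/
def predictFn (i : Fin L) (z' : α → Bool) (w : Fin L → Bool) : Bool :=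
  if D (hybrid e f i z' w) = true then w i else !(w i)

/-- **The NW predictor** for block `i` with advice `(z, w)` (CIKK §2.4, "circuit construction";
Arora–Barak 2009, proof of Lemma 20.15): on a challenge `x ∈ {0,1}^β`, complete `x` (placed on
the block `Sᵢ`) by `z` outside `Sᵢ` to a seed, form the `i`-th hybrid with `w`, and answer `wᵢ` if
`D` accepts it, `¬wᵢ` otherwise. As a function it uses `f` only through the values
`f(z'|_{Sⱼ})`, `j < i`, each depending on `≤ |Sᵢ ∩ Sⱼ|` bits of `x` (the tables of the
reconstruction algorithm). [cite: CarmosinoImpagliazzoKabanetsKolokolova2016, Thm. 2.11] -/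
noncomputable def nwPredictor (i : Fin L) (z : α → Bool) (w : Fin L → Bool) (x : β → Bool) :
    Bool :=
  predictFn e f D i (Function.extend (e i) x z) w

variable [Fintype β] [DecidableEq β]

/-- The **agreement** `Pr_x[h(x) = f(x)]` of a hypothesis `h` with `f` under the uniform
distribution (`h ∈ CKT~(f, ε)` iff `agreement h f ≥ 1 - ε`).
[cite: CarmosinoImpagliazzoKabanetsKolokolova2016, Def. 2.1] -/
noncomputable def agreement (h g : (β → Bool) → Bool) : ℝ :=
  ((univ.filter fun x : β → Bool => h x = g x).card : ℝ) / Fintype.card (β → Bool)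

/-- The agreement of the `i`-th NW predictor with `f`, averaged over uniform advice `(z, w)`.
[folklore] -/
noncomputable def predictorAgreement (i : Fin L) : ℝ :=
  (∑ p : (α → Bool) × (Fin L → Bool), agreement (nwPredictor e f D i p.1 p.2) f) /
    Fintype.card ((α → Bool) × (Fin L → Bool))

/-! #### Two re-randomisation lemmas -/

omit [Fintype α] [DecidableEq β] in
/-- Completing a uniform block by a uniform outside part gives a uniform seed: the map
`(z, x) ↦ (x ∪ z|_{Sᵢᶜ}, z|_{Sᵢ})` is an involution of `{0,1}^α × {0,1}ⁿ`. [folklore] -/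
theorem overwrite_involutive (u : β ↪ α) :
    Function.Involutive
      (fun p : (α → Bool) × (β → Bool) => (Function.extend u p.2 p.1, p.1 ∘ u)) := by
  rintro ⟨z, x⟩
  simp only [Prod.mk.injEq]
  constructor
  · funext a
    by_cases h : ∃ k, u k = a
    · obtain ⟨k, rfl⟩ := h
      rw [u.injective.extend_apply]; rfl
    · rw [Function.extend_apply' _ _ _ h, Function.extend_apply' _ _ _ h]
  · exact Function.extend_comp u.injective _ _

omit [Fintype α] [DecidableEq α] [Fintype β] [DecidableEq β] in
/-- Reading back the overwritten block. [folklore] -/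
theorem extend_comp_self (u : β ↪ α) (x : β → Bool) (z : α → Bool) :
    Function.extend u x z ∘ u = x :=
  Function.extend_comp u.injective _ _

/-- Summing `g(x ∪ z|_{Sᵢᶜ})` over all `(z, x)` counts every seed `2ⁿ` times. [folklore] -/
theorem sum_sum_extend (u : β ↪ α) (g : (α → Bool) → ℝ) :
    (∑ z : α → Bool, ∑ x : β → Bool, g (Function.extend u x z)) =
      Fintype.card (β → Bool) * ∑ z : α → Bool, g z := by
  have hinv := overwrite_involutive u
  let Ψ : Equiv.Perm ((α → Bool) × (β → Bool)) := hinv.toPerm _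
  calc (∑ z : α → Bool, ∑ x : β → Bool, g (Function.extend u x z))
      = ∑ p : (α → Bool) × (β → Bool), g (Ψ p).1 := by
        rw [Fintype.sum_prod_type]; rfl
    _ = ∑ p : (α → Bool) × (β → Bool), g p.1 :=
        Equiv.sum_comp Ψ (fun p : (α → Bool) × (β → Bool) => g p.1)
    _ = Fintype.card (β → Bool) * ∑ z : α → Bool, g z := by
        rw [Fintype.sum_prod_type]
        simp only [Finset.sum_const, Finset.card_univ, nsmul_eq_mul]
        rw [Finset.mul_sum]

omit [Fintype α] [DecidableEq α] in
/-- Pairing `w` with `w ⊕ eᵢ`: a sum over `w` is half the sum of the values at `w[i ↦ 1]` and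
`w[i ↦ 0]`. [folklore] -/
theorem sum_eq_half_sum_update (i : Fin L) (g : (Fin L → Bool) → ℝ) :
    (∑ w : Fin L → Bool, g w) =
      (∑ w : Fin L → Bool, (g (Function.update w i true) + g (Function.update w i false))) / 2 := by
  have hinv : Function.Involutive (fun w : Fin L → Bool => Function.update w i (!w i)) := by
    intro w; simp
  have h1 : (∑ w : Fin L → Bool, g w) = ∑ w : Fin L → Bool, g (Function.update w i (!w i)) :=
    (Equiv.sum_comp (hinv.toPerm _) g).symm
  have h2 : (∑ w : Fin L → Bool, (g (Function.update w i true) + g (Function.update w i false))) =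
      ∑ w : Fin L → Bool, (g w + g (Function.update w i (!w i))) := by
    refine Finset.sum_congr rfl fun w _ => ?_
    cases hw : w i
    · have h3 : Function.update w i false = w := by rw [← hw]; exact Function.update_eq_self i w
      rw [h3]; simp only [Bool.not_false]; rw [add_comm]
    · have h3 : Function.update w i true = w := by rw [← hw]; exact Function.update_eq_self i w
      rw [h3]; simp only [Bool.not_true]
  rw [h2, Finset.sum_add_distrib, ← h1]; ring

/-! #### Yao's step: the predictor's agreement is the hybrid gap -/

/-- **From distinguishing to predicting** (Yao): averaged over its advice, the `i`-th NW
predictor agrees with `f` with probability exactly `1/2 + (Pr[D(H_{i+1})] - Pr[D(H_i)])`.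
[Arora–Barak 2009, proof of Lemma 20.15 with Thm. 20.10 (Yao)]
[cite: CarmosinoImpagliazzoKabanetsKolokolova2016, Thm. 2.11] -/
theorem predictorAgreement_eq (i : Fin L) :
    predictorAgreement e f D i =
      1 / 2 + (hybridProb e f D ((i : ℕ) + 1) - hybridProb e f D i) := by
  have hA : (0 : ℝ) < Fintype.card (α → Bool) := Nat.cast_pos.2 Fintype.card_pos
  have hW : (0 : ℝ) < Fintype.card (Fin L → Bool) := Nat.cast_pos.2 Fintype.card_pos
  have hX : (0 : ℝ) < Fintype.card (β → Bool) := Nat.cast_pos.2 Fintype.card_pos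
  -- Step 1: re-randomise the seed; the agreement becomes a sum over completed seeds `z'`.
  have key1 : ∀ w : Fin L → Bool,
      (∑ z : α → Bool, agreement (nwPredictor e f D i z w) f) =
        ∑ z' : α → Bool, (if predictFn e f D i z' w = f (z' ∘ e i) then (1 : ℝ) else 0) := by
    intro w
    unfold agreement
    simp_rw [natCast_card_filter]
    rw [← Finset.sum_div]
    have : (∑ z : α → Bool, ∑ x : β → Bool,
        (if nwPredictor e f D i z w x = f x then (1 : ℝ) else 0)) =
        ∑ z : α → Bool, ∑ x : β → Bool,
          (fun z' : α → Bool => if predictFn e f D i z' w = f (z' ∘ e i) then (1 : ℝ) else 0)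
            (Function.extend (e i) x z) :=
      Finset.sum_congr rfl fun z _ => Finset.sum_congr rfl fun x _ => by
        simp only [nwPredictor, extend_comp_self]
        exact if_congr Iff.rfl rfl rfl
    rw [this, sum_sum_extend (e i)
      (fun z' : α → Bool => if predictFn e f D i z' w = f (z' ∘ e i) then (1 : ℝ) else 0),
      mul_div_assoc, mul_div_cancel₀ _ hX.ne']
  have step1 : (∑ p : (α → Bool) × (Fin L → Bool), agreement (nwPredictor e f D i p.1 p.2) f) =
      ∑ z' : α → Bool, ∑ w : Fin L → Bool,
        (if predictFn e f D i z' w = f (z' ∘ e i) then (1 : ℝ) else 0) := by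
    rw [Fintype.sum_prod_type]
    dsimp only
    rw [Finset.sum_comm, Finset.sum_congr rfl fun w _ => key1 w, Finset.sum_comm]
  -- Step 2 (Yao): for a fixed completed seed, pair `w` with `w ⊕ eᵢ`.
  have key2 : ∀ z' : α → Bool,
      (∑ w : Fin L → Bool, (if predictFn e f D i z' w = f (z' ∘ e i) then (1 : ℝ) else 0)) =
        (∑ w : Fin L → Bool, (if D (hybrid e f ((i : ℕ) + 1) z' w) = true then (1 : ℝ) else 0)) -
          (∑ w : Fin L → Bool, (if D (hybrid e f i z' w) = true then (1 : ℝ) else 0)) +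
            Fintype.card (Fin L → Bool) / 2 := by
    intro z'
    simp_rw [hybrid_succ, ← hybrid_update]
    generalize f (z' ∘ e i) = b
    suffices h : (∑ w : Fin L → Bool, ((if predictFn e f D i z' w = b then (1 : ℝ) else 0) +
        (if D (hybrid e f i z' w) = true then (1 : ℝ) else 0) -
        (if D (hybrid e f i z' (Function.update w i b)) = true then (1 : ℝ) else 0))) =
        Fintype.card (Fin L → Bool) / 2 by
      rw [Finset.sum_sub_distrib, Finset.sum_add_distrib] at h; linarith
    rw [sum_eq_half_sum_update i]
    congr 1
    rw [show (Fintype.card (Fin L → Bool) : ℝ) = ∑ _w : Fin L → Bool, (1 : ℝ) by simp]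
    refine Finset.sum_congr rfl fun w _ => ?_
    simp only [predictFn, Function.update_self, Function.update_idem]
    cases b <;> cases ht : D (hybrid e f i z' (Function.update w i true)) <;>
      cases hf : D (hybrid e f i z' (Function.update w i false)) <;> norm_num
  -- Step 3: assemble.
  unfold predictorAgreement hybridProb
  rw [step1, Finset.sum_congr rfl fun z' _ => key2 z', Finset.sum_add_distrib,
    Finset.sum_sub_distrib, natCast_card_filter, natCast_card_filter, Fintype.sum_prod_type,
    Fintype.sum_prod_type]
  dsimp only
  rw [Fintype.card_prod, Nat.cast_mul, Finset.sum_const, Finset.card_univ, nsmul_eq_mul]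
  field_simp
  ring

/-- **NW reconstruction, averaged form** (correctness of the algorithm of CIKK Thm. 2.11 /
Arora–Barak 2009, proof of Lemma 20.15): for a uniformly random block `i` and uniform advice
`(z, w)` the NW predictor agrees with `f` with probability `1/2 + advantage/L` on average. No
design property is needed for correctness (it only controls the size of the predictor).
[cite: CarmosinoImpagliazzoKabanetsKolokolova2016, Thm. 2.11] -/
theorem sum_predictorAgreement_div (hL : 0 < L) :
    (∑ i : Fin L, predictorAgreement e f D i) / L =
      1 / 2 + advantage D (nwGenerator e f) / L := by
  have hL' : (L : ℝ) ≠ 0 := Nat.cast_ne_zero.2 hL.ne'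
  simp_rw [predictorAgreement_eq]
  rw [Finset.sum_add_distrib, Finset.sum_const, Finset.card_univ, Fintype.card_fin, nsmul_eq_mul,
    ← advantage_eq_sum_hybridProb]
  field_simp

/-- **NW reconstruction, existence form** (Arora–Barak 2009, proof of Lemma 20.15; the non-uniform
content of CIKK Thm. 2.11): some block `i` and advice `(z, w)` give a predictor agreeing with `f`
on at least a `1/2 + advantage/L` fraction of inputs.
[cite: CarmosinoImpagliazzoKabanetsKolokolova2016, Thm. 2.11] -/
theorem exists_nwPredictor_agreement_ge (hL : 0 < L) :
    ∃ (i : Fin L) (z : α → Bool) (w : Fin L → Bool),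
      1 / 2 + advantage D (nwGenerator e f) / L ≤ agreement (nwPredictor e f D i z w) f := by
  have hL' : (0 : ℝ) < L := Nat.cast_pos.2 hL
  haveI : Nonempty (Fin L) := ⟨⟨0, hL⟩⟩
  have hcard : (0 : ℝ) < Fintype.card ((α → Bool) × (Fin L → Bool)) :=
    Nat.cast_pos.2 Fintype.card_pos
  obtain ⟨i, -, hi⟩ := Finset.exists_le_of_sum_le (s := (univ : Finset (Fin L)))
      (f := fun _ => 1 / 2 + advantage D (nwGenerator e f) / L)
      (g := fun i => predictorAgreement e f D i) univ_nonempty (by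
        have h := sum_predictorAgreement_div e f D hL
        rw [div_eq_iff hL'.ne'] at h
        rw [Finset.sum_const, Finset.card_univ, Fintype.card_fin, nsmul_eq_mul, h]
        linarith)
  obtain ⟨p, -, hp⟩ := Finset.exists_le_of_sum_le
      (s := (univ : Finset ((α → Bool) × (Fin L → Bool))))
      (f := fun _ => predictorAgreement e f D i)
      (g := fun p => agreement (nwPredictor e f D i p.1 p.2) f) univ_nonempty (by
        rw [Finset.sum_const, Finset.card_univ, nsmul_eq_mul]
        unfold predictorAgreement
        rw [mul_div_cancel₀ _ hcard.ne'])
  exact ⟨i, p.1, p.2, hi.trans hp⟩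

end Hybrid

/-! ### Natural properties as distinguishers (CIKK Thm. 5.1, second paragraph of the proof) -/

section NaturalDistinguisher

open Complexity

/-- The membership test of the combinatorial property `R` at length `ℓ`, as a Boolean function
on truth tables `{0,1}^{2^ℓ}` (a noncomputable indicator; its COMPLEXITY is the constructivity
of `R`, not used here). [cite: CarmosinoImpagliazzoKabanetsKolokolova2016, Def. 2.6] -/
noncomputable def propertyTest (R : CombinatorialProperty) (ℓ : ℕ) :
    ((Fin ℓ → Bool) → Bool) → Bool :=
  fun g => @decide (g ∈ R ℓ) (Classical.dec _)

/-- `propertyTest R ℓ g = true ↔ g ∈ R_ℓ`. [folklore] -/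
@[simp] theorem propertyTest_eq_true_iff (R : CombinatorialProperty) (ℓ : ℕ)
    (g : (Fin ℓ → Bool) → Bool) : propertyTest R ℓ g = true ↔ g ∈ R ℓ := by
  unfold propertyTest; exact @decide_eq_true_iff _ (Classical.dec _)

/-- **Largeness gives acceptance**: if `R` has density `≥ 1/q` at length `ℓ`
(`2^(2^ℓ) ≤ q · |R_ℓ|`), a uniform truth table passes the test with probability `≥ 1/q`.
[cite: CarmosinoImpagliazzoKabanetsKolokolova2016, Thm. 5.1 (proof, largeness step)] -/
theorem acceptProb_propertyTest_ge (R : CombinatorialProperty) (ℓ : ℕ) {q : ℕ} (hq : 0 < q)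
    (hR : 2 ^ (2 ^ ℓ) ≤ q * Nat.card (R ℓ)) :
    (1 : ℝ) / q ≤ acceptProb (propertyTest R ℓ) := by
  classical
  unfold acceptProb
  have hcard : Fintype.card (((Fin ℓ → Bool) → Bool)) = 2 ^ (2 ^ ℓ) := by
    simp [Fintype.card_bool, Fintype.card_fin]
  have hfilter : (univ.filter fun y : (Fin ℓ → Bool) → Bool => propertyTest R ℓ y = true).card =
      Nat.card (R ℓ) := by
    rw [Nat.card_eq_card_toFinset]
    congr 1
    ext g
    simp
  rw [hfilter, hcard, div_le_div_iff₀ (by exact_mod_cast hq) (by positivity), one_mul]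
  exact_mod_cast (mul_comm q _ ▸ hR)

variable {σ : Type*} [Fintype σ] [DecidableEq σ]

/-- If no output of the generator has the property, the test never accepts a pseudorandom
string. [cite: CarmosinoImpagliazzoKabanetsKolokolova2016, Thm. 5.1 (proof, usefulness step)] -/
theorem acceptProbOn_propertyTest_eq_zero (R : CombinatorialProperty) (ℓ : ℕ)
    (G : (σ → Bool) → ((Fin ℓ → Bool) → Bool)) (hG : ∀ z, G z ∉ R ℓ) :
    acceptProbOn (propertyTest R ℓ) G = 0 := by
  unfold acceptProbOn
  rw [Finset.filter_eq_empty_iff.2 (fun z _ => by simp [hG z]), Finset.card_empty, Nat.cast_zero,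
    zero_div]

omit [Fintype σ] [DecidableEq σ] in
/-- **Usefulness step**: if at length `ℓ` every function with the property has circuit size
`> u ℓ` (the `ℓ`-th instance of `IsUsefulAgainstSize u R`) while every output `G z` of the
generator has a `B₂`-circuit of size `≤ u ℓ`, then no output has the property.
[cite: CarmosinoImpagliazzoKabanetsKolokolova2016, Thm. 5.1 (proof, usefulness step)] -/
theorem forall_not_mem_of_useful (R : CombinatorialProperty) (ℓ : ℕ) {u : ℕ → ℕ}
    (hu : ∀ g ∈ R ℓ, u ℓ < circuitSizeOver B2 g) (G : (σ → Bool) → ((Fin ℓ → Bool) → Bool))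
    (hG : ∀ z, circuitSizeOver B2 (G z) ≤ u ℓ) : ∀ z, G z ∉ R ℓ :=
  fun z hz => absurd (hG z) (not_le.2 (hu _ hz))

/-- The per-length instances of usefulness beyond a threshold (unfolding `IsUsefulAgainstSize`).
[folklore] -/
theorem IsUsefulAgainstSize.exists_threshold {u : ℕ → ℕ} {R : CombinatorialProperty}
    (h : IsUsefulAgainstSize u R) : ∃ ℓ₀, ∀ ℓ ≥ ℓ₀, ∀ g ∈ R ℓ, u ℓ < circuitSizeOver B2 g :=
  Filter.eventually_atTop.1 h

/-- **CIKK Thm. 5.1, the distinguisher step**: a property of density `≥ 1/q` at length `ℓ` that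
no generator output possesses yields the distinguisher `¬R_ℓ` with advantage `≥ 1/q` against the
generator (CIKK: "by usefulness `Pr_z[¬D(g_z) = 1] = 1`, and by largeness
`Pr_y[¬D(y) = 1] ≤ 1 - 1/5`, so `¬D` is a `1/5`-distinguisher"). CAVEAT (`≥` versus `>`): CIKK's
`DIS(G, ε)` (Def. 2.10) asks for a STRICT inequality, so density exactly `1/5` gives
`¬D ∈ DIS(G, ε)` only for `ε < 1/5`; what is proved here is the non-strict bound
`advantage ≥ 1/q`, and later steps should consume it through the exact averaged form
`sum_predictorAgreement_div` (agreement `1/2 + advantage/L` on average), not through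
membership in `DIS(·, 1/5)` literally.
[cite: CarmosinoImpagliazzoKabanetsKolokolova2016, Thm. 5.1] -/
theorem advantage_not_propertyTest_ge (R : CombinatorialProperty) (ℓ : ℕ) {q : ℕ} (hq : 0 < q)
    (hR : 2 ^ (2 ^ ℓ) ≤ q * Nat.card (R ℓ)) (G : (σ → Bool) → ((Fin ℓ → Bool) → Bool))
    (hG : ∀ z, G z ∉ R ℓ) :
    (1 : ℝ) / q ≤ advantage (fun y => !propertyTest R ℓ y) G := by
  rw [advantage_not, advantage, acceptProbOn_propertyTest_eq_zero R ℓ G hG, zero_sub, neg_neg]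
  exact acceptProb_propertyTest_ge R ℓ hq hR

end NaturalDistinguisher

end Literature.Computability.MetaComplexity
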